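import Literature.MathematicalPhysics.QuantumLattice.DWaveSourceEnergyDensityTPPTransport
import Literature.MathematicalPhysics.QuantumLattice.HubbardTTPrimeAnchorWordBoxTransport
import HarnessLib

/-!
# The pair-amplitude ceiling of object M AT FIXED FILLING: the `n`-form of the order-word seam
# (one sourced floor at an anchor `(t'₀, U₀, μ₀, h)`, fixed-filling energy caps, NO chemical potential
# of the box, NO source-free grand-canonical cap)

Topic `Literature/MathematicalPhysics/QuantumLattice` (family `hubbard`). Typed by cell `pub/hubbard-fast`,
seat hubbard-fast-p1 g16 (R1b box-certificate / transport planner; pen sketch sha16 dec2923a4845f11a), landed verbatim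
by seat hubbard-fast-lit g14; written for the downfold seam
(`Summits/Ventures/CertifiedManyBodySolver/Downfold/TppSeamOrder.lean`, hubbard-downfold-mod-1: «`μ ↔ n` is NOT
resolved here — a material box carries the filling `n`, the word is uniform over a `μ`-interval the S2 side
must choose»). Companion of `DWaveSourceEnergyDensityTPPTransport.lean` §4 (the `μ`-form
`meanEnergy_pairSource_le_of_windows_couplings4`:
`e_P(σ) ≤ (hi₀ − lo + 8|t' − t'₀| + |U − U₀| + 2|μ − μ₀| + (32/π²)|t''| + ε)/h` for near-minimisers of
`H_M − μN`).

THE `n`-FORM. Fix `h > 0`, an anchor `(t'₀, U₀, μ₀)` and ONE certified SOURCED floor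
`lo ≤ e_src(t'₀,U₀,μ₀,h)` (object E, `t'' = 0`). Let `σ` be a translation-invariant state of density `n`
which is an `ε`-near minimiser of the source-FREE object-M mean energy `e^{1,t',t'',U}` OVER THE FILLING
CLASS `{τ translation invariant, ρ(τ) = n}` (the programme's state class for words at filling `n`:
torus-limit ground states at fixed filling minimise over it, `IsTorusLimitOf.meanEnergy_le_of_filling`).
Then for every translation-invariant comparison state `ω` of the same density `n`
(`mul_meanEnergy_pairSource_le_of_comparison_filling_coords`, products explicit):

  `h·e_P(σ) ≤ e^{1,t'₀,U₀}(ω) − μ₀·n − lo + ε + (t'−t'₀)(K₂(ω)−K₂(σ)) + (U−U₀)(D(ω)−D(σ)) + t''(K₃(ω)−K₃(σ))`,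

so with the class-wide rows for both states (`mul_meanEnergy_pairSource_le_of_comparison_filling`)

  `h·e_P(σ) ≤ e^{1,t'₀,U₀}(ω) − μ₀·n − lo + (32/π²)|t' − t'₀| + (n/2)|U − U₀| + (32/π²)|t''| + ε`,

or, with the comparison state's own conjugate densities certified — `|K₂(ω)| ≤ s₂`, `|K₃(ω)| ≤ s₃`,
`D(ω) ∈ [dlo, dhi]` (the anchor ground state's `HOP2±`, `HOP3±`, `D±` rows) —
(`…_comparison_filling_slopes`, `meanEnergy_pairSource_le_of_cappedAnchorState_slopes`, ABSENT form
`…_cappedAnchorState_slopes_near`) the costs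
`(16/π² + s₂)|t' − t'₀| + (16/π² + s₃)|t''| + max((U − U₀)dhi, (U₀ − U)(n/2 − dlo))` — above the anchor the
`U`-cost is the tangent `(U − U₀)·dhi`, the anchor's certified double occupancy;

hence with a certified fixed-filling CAP `e(1,t'₀,U₀,n) ≤ cap` (`U₀ ≥ 0`, `0 < n < 2`;
`meanEnergy_pairSource_le_of_fillingCap_couplings`):

  `e_P(σ) ≤ (cap − μ₀·n − lo + (32/π²)|t' − t'₀| + (n/2)|U − U₀| + (32/π²)|t''| + ε)/h`.

WHAT IT BUYS. (i) No chemical potential of the box appears: the `2|μ − μ₀|` term of the `μ`-form is GONE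
(the anchor's `μ₀` is a free parameter of the certificate, not a property of `σ`). (ii) The resource
`cap(n) − μ₀n − lo` replaces `hi₀ − lo`; since `e_src(t'₀,U₀,μ₀,0) = inf_m (e(m) − μ₀m)` (Legendre), at the
anchor's own filling the two coincide and off it the `n`-form pays only the Legendre defect
`e(n) − μ₀n − min_m (e(m) − μ₀m)`, SECOND order in `n − n(μ₀)`, where the `μ`-form pays `2|μ(n) − μ₀|`, FIRST
order and requiring `μ(n)`. (iii) The `t'` cost is the class row `32/π² ≈ 3.24` per unit (not `8`), the `U`
cost `n/2` per unit (not `1`): the three conjugate densities `K₂, K₃ ∈ [−16/π², 16/π²]`, `D ∈ [0, n/2]` of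
BOTH `σ` and the comparison state enter only through their DIFFERENCES. (iv) ON A FILLING SLAB
`[n₁, n₂] ⊂ (0,2)`: `e(1,t'₀,U₀,·)` is convex (`convexOn_energyDensityTT'`), so two endpoint caps `c₁, c₂`
cap the whole slab by their chord and the resource is `≤ max(c₁ − μ₀n₁, c₂ − μ₀n₂) − lo`
(`energyDensityTT'_sub_mul_le_max_of_caps`); the ABSENT(`< m₀`) word then holds UNIFORMLY on
`[n₁,n₂] × (t',U,t'')`-box from THREE certified numbers `(lo; c₁, c₂)` and no `μ(n)`
(`meanEnergy_pairSource_lt_of_slabCaps_of_minimiser_near`). Choosing `μ₀` = the chord slope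
`(c₂ − c₁)/(n₂ − n₁)` balances the two ends.

RELATION TO `Summits/…/Downfold/TppSeamOrderFilling.lean` (hubbard-downfold-mod-1, p486156, landed while this
file was being typed): the same `n`-form resource `cap − μ₀n − lo` with `μ₀` free; there the sourced FLOOR is
transported from the anchor to the member's `(t', U)` (`4|Δt'|` — `16/π²` with
`dWaveSourceEnergyDensityTT'_ge_of_ge_tp_kinematic` — and `0` upward in `U`) and the cap is the S2 cell-wide
window `R` at the member, `t''` costing `(32/π²)m`. Here instead the sourced principle is used AT THE ANCHOR and
the member enters through one comparison state at the anchor: the inputs are POINT data of one anchor solve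
(`u, s₂, s₃, dlo, dhi; lo`), no cell-wide window; the `t''` cost is `(16/π² + s₃)m` as soon as a third-neighbour
bond row `|K₃(ω₀)| ≤ s₃` of the anchor state is certified (La-214 `m = 0.14`: `0.454 → 0.227 + 0.14·s₃`); the `U`-cost
above the anchor is the tangent `(U − U₀)·dhi` (p486156's window form `R − lo` pays the true secant instead,
which is smaller on wide `U`-cells: use it, or `U` sub-cells, there; and the `U`-direction made SECOND order
from TWO anchors — chord floors, docc-word tangent caps — is `DWaveOrderParameterUCells.lean`, hubbard-downfold-unc-1,
p487989, whose §6 is the `μ`-form currency with the `U`-bulge). La-214 at `s₃ ≈ 0.05–0.2` [est, free gas at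
`t' = −0.1`, `n = 0.875`: `K₃ ≈ −0.045`]. The forms are complements, not rivals.

* §1 a signed-product helper.
* §2 the comparison identity, its kinematic-row and anchor-slope forms, the cap forms (near-minimisers), the
  `ε = 0` filling-class-minimiser form, the ABSENT(`< m₀`) form on an explicit `(t',U,t'')` box at filling `n`.
* §3 the slab: chord cap of the resource, ABSENT uniformly on `[n₁,n₂] ×` box.

Everything here is PROVED; no definition, no named fact, no number, no `sorry`. HONEST SCOPE: ceiling-side
(ABSENT-side) bookkeeping at the VARIATIONAL level exactly as the companion files (translation-invariant
mean-energy near-minimisers over the filling class; for `t'' ≠ 0` the identification of the fixed-filling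
variational density with a torus thermodynamic limit is not in the tree); nothing here FLOORS order or bears
on `T_c`; the inputs `lo` (a sourced floor — a real solve with the pair field on) and `cap` (fixed-filling
energy caps — trial states) are certified elsewhere; no number about any material is certified by this file.

## Mathlib / tree search

Tree (REUSED): `tiGroundEnergyDensity_tppSourced_ge_of_le`, `InfVolFermionState.meanEnergy_hubbardTT'T''Sourced`,
`hubbardTT'T''SourcedInteraction` (`DWaveSourceEnergyDensityTPPTransport`); `FermionInteraction.tiGroundEnergyDensity_le_meanEnergy`;
`FermionInteraction.tiGroundEnergyDensityAt_le_meanEnergy`, `le_tiGroundEnergyDensityAt` (`TIGroundEnergyDensityCouplingFamilies`);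
`InfVolFermionState.meanEnergy_hubbardTT'T''` (`HubbardTTPrimeTPPInteraction`); `meanEnergy_hubbardTTPrime_eq_one`
(`HubbardTTPrimeTPPFillingTransport`); `meanEnergy_hubbardTTPrime_eq_coords` (`HubbardTTPrimeCapCutDualRows`);
`IsTranslationInvariant.abs_meanEnergy_diagHop_le_of_any_density`, `…axialRange2Hopping_le_of_any_density`
(`HubbardTTPrimeKinematicRowsAllFillings`); `meanEnergy_hubbardTTPrime_onSite_mem_Icc` (`HubbardTTPrimeAnchorWordBoxTransport`);
`isLeast_meanEnergy_energyDensityTT'` (`HubbardTTPrimeEnergyDensityVariationalPrinciple`); `convexOn_energyDensityTT'`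
(`HubbardNNNHoppingEnergyDensityConvex`). `lean search 'pairSource.*filling|fillingCap'`: nothing.

## References

* T. Koma, H. Tasaki, Commun. Math. Phys. 158 (1994) 191, §1 (pair field, induced pair amplitude).
  [cite: KomaTasaki1994, §1]
* R. B. Griffiths, Phys. Rev. 152 (1966) 240, §II (secant bounds on derivatives of concave functions).
  [cite: Griffiths1966, §II]
* D. Ruelle, *Statistical Mechanics* (1969), §3.4 (variational principle at fixed density; convexity in the
  density; Legendre duality of the ensembles). [cite: Ruelle1969, §3.4]
* R. B. Israel, *Convexity in the Theory of Lattice Gases* (1979), Thm. I.3.4. [cite: Israel1979, Thm. I.3.4]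
* J. Wang et al., PRX 14 (2024) 031006, §III (energy-constrained relaxations). [cite: WangEtAl2024, §III]
* E. H. Lieb, M. Loss, Duke Math. J. 71 (1993) 337, §8 Thm. 8.2 (bathtub; the kinematic rows).
  [cite: LiebLoss1993, §8, Theorem 8.2]
-/

noncomputable section

namespace Literature.MathematicalPhysics.QuantumLattice

open Literature.Probability.LatticeModels ThermodynamicLimit

/-! ### §1 A signed-product helper -/

/-- `c·x ≤ |c|·a` whenever `|x| ≤ a`. [folklore] -/
private theorem mul_le_abs_mul_of_abs_le {c x a : ℝ} (hx : |x| ≤ a) : c * x ≤ |c| * a :=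
  calc c * x ≤ |c * x| := le_abs_self _
    _ = |c| * |x| := abs_mul c x
    _ ≤ |c| * a := mul_le_mul_of_nonneg_left hx (abs_nonneg c)

/-! ### §2 The `n`-form of the pair-amplitude ceiling of object M -/

section NForm

/-- **COMPARISON IDENTITY (the master inequality, products explicit).** `h`, an anchor `(t'₀,U₀,μ₀)` with
a sourced floor `lo ≤ e_src(t'₀,U₀,μ₀,h)`; `σ` translation invariant of density `n`, an `ε`-near minimiser of
the source-free object-M mean energy `e^{1,t',t'',U}` over the filling class; `ω` any translation-invariant
state of density `n`. Then, with `K₂, K₃, D` the diagonal-hopping, third-neighbour-hopping and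
double-occupancy densities,
`h·e_P(σ) ≤ e^{1,t'₀,U₀}(ω) − μ₀n − lo + ε + (t' − t'₀)(K₂(ω) − K₂(σ)) + (U − U₀)(D(ω) − D(σ)) + t''(K₃(ω) − K₃(σ))`.
Proof: sourced variational principle at the anchor (`lo ≤ e^M_h(σ) = e^{1,t'₀,0,U₀}(σ) − μ₀n − h·e_P(σ)`),
fixed-filling variational principle at `(t',t'',U)` for `ω`, affinity of both mean energies in the
couplings. [cite: KomaTasaki1994, §1] -/
theorem mul_meanEnergy_pairSource_le_of_comparison_filling_coords {t'₀ U₀ μ₀ h lo n ε : ℝ}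
    (hlo : lo ≤ dWaveSourceEnergyDensityTT' t'₀ U₀ μ₀ h) (t' U t'' : ℝ)
    {σ : InfVolFermionState 2} (hσ : σ.IsTranslationInvariant) (hσn : σ.density = n)
    (hε : σ.meanEnergy (hubbardTT'T''FermionInteraction 1 t' t'' U) 2 ≤
      (hubbardTT'T''FermionInteraction 1 t' t'' U).tiGroundEnergyDensityAt 2 n + ε)
    {ω : InfVolFermionState 2} (hω : ω.IsTranslationInvariant) (hωn : ω.density = n) :
    h * σ.meanEnergy (pairSourceInteraction dWaveFormFactor) 1 ≤
      ω.meanEnergy (hubbardTTPrimeFermionInteraction 1 t'₀ U₀) 1 - μ₀ * n - lo + ε +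
        (t' - t'₀) * (ω.meanEnergy (hubbardTTPrimeFermionInteraction 0 1 0) 1 -
          σ.meanEnergy (hubbardTTPrimeFermionInteraction 0 1 0) 1) +
        (U - U₀) * (ω.meanEnergy (hubbardTTPrimeFermionInteraction 0 0 1) 1 -
          σ.meanEnergy (hubbardTTPrimeFermionInteraction 0 0 1) 1) +
        t'' * (ω.meanEnergy (axialRange2HoppingFermionInteraction 2 1) 2 -
          σ.meanEnergy (axialRange2HoppingFermionInteraction 2 1) 2) := by
  -- sourced variational principle at the anchor (object E = object M at `t'' = 0`)
  have hfloor := tiGroundEnergyDensity_tppSourced_ge_of_le hlo 0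
  rw [abs_zero, mul_zero, sub_zero] at hfloor
  have hvar := (hubbardTT'T''SourcedInteraction 1 t'₀ 0 U₀ μ₀ dWaveFormFactor h).tiGroundEnergyDensity_le_meanEnergy
    2 hσ
  have hsrc := σ.meanEnergy_hubbardTT'T''Sourced 1 t'₀ 0 U₀ μ₀ dWaveFormFactor h
  rw [hσn] at hsrc
  -- fixed-filling variational principle at `(t', t'', U)` for the comparison state
  have hvarω := (hubbardTT'T''FermionInteraction 1 t' t'' U).tiGroundEnergyDensityAt_le_meanEnergy 2 hω hωn
  -- affinity in the couplings
  have hσ0 := σ.meanEnergy_hubbardTT'T'' 1 t'₀ 0 U₀ 2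
  have hσθ := σ.meanEnergy_hubbardTT'T'' 1 t' t'' U 2
  have hωθ := ω.meanEnergy_hubbardTT'T'' 1 t' t'' U 2
  rw [σ.meanEnergy_hubbardTTPrime_eq_one 1 _ _ (by norm_num : (1 : ℝ) ≤ 2)] at hσ0 hσθ
  rw [ω.meanEnergy_hubbardTTPrime_eq_one 1 _ _ (by norm_num : (1 : ℝ) ≤ 2)] at hωθ
  have cσ0 := σ.meanEnergy_hubbardTTPrime_eq_coords 1 t'₀ U₀
  have cσ := σ.meanEnergy_hubbardTTPrime_eq_coords 1 t' U
  have cω0 := ω.meanEnergy_hubbardTTPrime_eq_coords 1 t'₀ U₀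
  have cω := ω.meanEnergy_hubbardTTPrime_eq_coords 1 t' U
  linarith [hfloor, hvar, hsrc, hvarω, hε, hσ0, hσθ, hωθ, cσ0, cσ, cω0, cω]

/-- **COMPARISON FORM, kinematic rows.** Same data; the conjugate densities of BOTH states obey the
class-wide rows `K₂, K₃ ∈ [−16/π², 16/π²]`, `D ∈ [0, n/2]`, so
`h·e_P(σ) ≤ e^{1,t'₀,U₀}(ω) − μ₀n − lo + (32/π²)|t' − t'₀| + (n/2)|U − U₀| + (32/π²)|t''| + ε`.
[cite: LiebLoss1993, §8, Theorem 8.2] -/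
theorem mul_meanEnergy_pairSource_le_of_comparison_filling {t'₀ U₀ μ₀ h lo n ε : ℝ}
    (hlo : lo ≤ dWaveSourceEnergyDensityTT' t'₀ U₀ μ₀ h) (t' U t'' : ℝ)
    {σ : InfVolFermionState 2} (hσ : σ.IsTranslationInvariant) (hσn : σ.density = n)
    (hε : σ.meanEnergy (hubbardTT'T''FermionInteraction 1 t' t'' U) 2 ≤
      (hubbardTT'T''FermionInteraction 1 t' t'' U).tiGroundEnergyDensityAt 2 n + ε)
    {ω : InfVolFermionState 2} (hω : ω.IsTranslationInvariant) (hωn : ω.density = n) :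
    h * σ.meanEnergy (pairSourceInteraction dWaveFormFactor) 1 ≤
      ω.meanEnergy (hubbardTTPrimeFermionInteraction 1 t'₀ U₀) 1 - μ₀ * n - lo +
        32 / Real.pi ^ 2 * |t' - t'₀| + n / 2 * |U - U₀| + 32 / Real.pi ^ 2 * |t''| + ε := by
  have hA := mul_meanEnergy_pairSource_le_of_comparison_filling_coords hlo t' U t'' hσ hσn hε hω hωn
  -- class-wide rows of the conjugate densities
  have hK2σ := abs_le.1 hσ.abs_meanEnergy_diagHop_le_of_any_density
  have hK2ω := abs_le.1 hω.abs_meanEnergy_diagHop_le_of_any_density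
  have hK3σ := abs_le.1 hσ.abs_meanEnergy_axialRange2Hopping_le_of_any_density
  have hK3ω := abs_le.1 hω.abs_meanEnergy_axialRange2Hopping_le_of_any_density
  have hDσ := σ.meanEnergy_hubbardTTPrime_onSite_mem_Icc hσn
  have hDω := ω.meanEnergy_hubbardTTPrime_onSite_mem_Icc hωn
  -- the three signed products, bounded by |Δθ| × (width of the bracket); `32/π² = 2·(16/π²)` is spelled
  -- out because `linarith` treats `16/π²` and `32/π²` as unrelated atoms
  have h32 : (32 : ℝ) / Real.pi ^ 2 = 2 * (16 / Real.pi ^ 2) := by ring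
  have p2 : (t' - t'₀) * (ω.meanEnergy (hubbardTTPrimeFermionInteraction 0 1 0) 1 -
      σ.meanEnergy (hubbardTTPrimeFermionInteraction 0 1 0) 1) ≤ |t' - t'₀| * (2 * (16 / Real.pi ^ 2)) :=
    mul_le_abs_mul_of_abs_le (abs_le.2 ⟨by linarith [hK2σ.2, hK2ω.1], by linarith [hK2σ.1, hK2ω.2]⟩)
  have p3 : t'' * (ω.meanEnergy (axialRange2HoppingFermionInteraction 2 1) 2 -
      σ.meanEnergy (axialRange2HoppingFermionInteraction 2 1) 2) ≤ |t''| * (2 * (16 / Real.pi ^ 2)) :=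
    mul_le_abs_mul_of_abs_le (abs_le.2 ⟨by linarith [hK3σ.2, hK3ω.1], by linarith [hK3σ.1, hK3ω.2]⟩)
  have pD : (U - U₀) * (ω.meanEnergy (hubbardTTPrimeFermionInteraction 0 0 1) 1 -
      σ.meanEnergy (hubbardTTPrimeFermionInteraction 0 0 1) 1) ≤ |U - U₀| * (n / 2) :=
    mul_le_abs_mul_of_abs_le (abs_le.2 ⟨by linarith [hDσ.2, hDω.1], by linarith [hDσ.1, hDω.2]⟩)
  rw [h32]
  linarith [hA, p2, p3, pD]

/-- **COMPARISON FORM, anchor-state slopes and docc bracket.** Same data, the comparison state's own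
conjugate densities bracketed — `|K₂(ω)| ≤ s₂`, `|K₃(ω)| ≤ s₃`, `D(ω) ∈ [dlo, dhi]` (e.g. the certified
correlator windows of the anchor's ground state: `HOP2±`, a third-neighbour `HOP3±` row, `D±`; the unknown box
state `σ` keeps the class-wide rows `|K₂|,|K₃| ≤ 16/π²`, `D ∈ [0, n/2]`):
`h·e_P(σ) ≤ e^{1,t'₀,U₀}(ω) − μ₀n − lo + (16/π² + s₂)|t' − t'₀| + (16/π² + s₃)|t''|`
`          + max((U − U₀)·dhi, (U₀ − U)·(n/2 − dlo)) + ε`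
— ABOVE the anchor (`U ≥ U₀`) the `U`-cost is the TANGENT `(U − U₀)·dhi` (the anchor's certified double
occupancy, `≈ 0.05–0.1` at `U/t ≈ 6–8`, not the kinematic `n/2`). [cite: WangEtAl2024, §III] -/
theorem mul_meanEnergy_pairSource_le_of_comparison_filling_slopes {t'₀ U₀ μ₀ h lo n ε s₂ s₃ dlo dhi : ℝ}
    (hlo : lo ≤ dWaveSourceEnergyDensityTT' t'₀ U₀ μ₀ h) (t' U t'' : ℝ)
    {σ : InfVolFermionState 2} (hσ : σ.IsTranslationInvariant) (hσn : σ.density = n)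
    (hε : σ.meanEnergy (hubbardTT'T''FermionInteraction 1 t' t'' U) 2 ≤
      (hubbardTT'T''FermionInteraction 1 t' t'' U).tiGroundEnergyDensityAt 2 n + ε)
    {ω : InfVolFermionState 2} (hω : ω.IsTranslationInvariant) (hωn : ω.density = n)
    (hs₂ : |ω.meanEnergy (hubbardTTPrimeFermionInteraction 0 1 0) 1| ≤ s₂)
    (hs₃ : |ω.meanEnergy (axialRange2HoppingFermionInteraction 2 1) 2| ≤ s₃)
    (hd : ω.meanEnergy (hubbardTTPrimeFermionInteraction 0 0 1) 1 ∈ Set.Icc dlo dhi) :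
    h * σ.meanEnergy (pairSourceInteraction dWaveFormFactor) 1 ≤
      ω.meanEnergy (hubbardTTPrimeFermionInteraction 1 t'₀ U₀) 1 - μ₀ * n - lo +
        (16 / Real.pi ^ 2 + s₂) * |t' - t'₀| + (16 / Real.pi ^ 2 + s₃) * |t''| +
        max ((U - U₀) * dhi) ((U₀ - U) * (n / 2 - dlo)) + ε := by
  have hA := mul_meanEnergy_pairSource_le_of_comparison_filling_coords hlo t' U t'' hσ hσn hε hω hωn
  have hK2σ := abs_le.1 hσ.abs_meanEnergy_diagHop_le_of_any_density
  have hK2ω := abs_le.1 hs₂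
  have hK3σ := abs_le.1 hσ.abs_meanEnergy_axialRange2Hopping_le_of_any_density
  have hK3ω := abs_le.1 hs₃
  have hDσ := σ.meanEnergy_hubbardTTPrime_onSite_mem_Icc hσn
  have p2 : (t' - t'₀) * (ω.meanEnergy (hubbardTTPrimeFermionInteraction 0 1 0) 1 -
      σ.meanEnergy (hubbardTTPrimeFermionInteraction 0 1 0) 1) ≤ |t' - t'₀| * (16 / Real.pi ^ 2 + s₂) :=
    mul_le_abs_mul_of_abs_le (abs_le.2 ⟨by linarith [hK2σ.2, hK2ω.1], by linarith [hK2σ.1, hK2ω.2]⟩)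
  have p3 : t'' * (ω.meanEnergy (axialRange2HoppingFermionInteraction 2 1) 2 -
      σ.meanEnergy (axialRange2HoppingFermionInteraction 2 1) 2) ≤ |t''| * (16 / Real.pi ^ 2 + s₃) :=
    mul_le_abs_mul_of_abs_le (abs_le.2 ⟨by linarith [hK3σ.2, hK3ω.1], by linarith [hK3σ.1, hK3ω.2]⟩)
  -- the docc product, one-sided: above the anchor only `D(ω) ≤ dhi` and `D(σ) ≥ 0` are used
  have pD : (U - U₀) * (ω.meanEnergy (hubbardTTPrimeFermionInteraction 0 0 1) 1 -
      σ.meanEnergy (hubbardTTPrimeFermionInteraction 0 0 1) 1) ≤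
      max ((U - U₀) * dhi) ((U₀ - U) * (n / 2 - dlo)) := by
    rcases le_total U₀ U with hU | hU
    · refine le_trans ?_ (le_max_left _ _)
      exact mul_le_mul_of_nonneg_left (by linarith [hd.2, hDσ.1]) (sub_nonneg.2 hU)
    · refine le_trans ?_ (le_max_right _ _)
      have h1 : (U - U₀) * (ω.meanEnergy (hubbardTTPrimeFermionInteraction 0 0 1) 1 -
          σ.meanEnergy (hubbardTTPrimeFermionInteraction 0 0 1) 1) =
          (U₀ - U) * (σ.meanEnergy (hubbardTTPrimeFermionInteraction 0 0 1) 1 -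
            ω.meanEnergy (hubbardTTPrimeFermionInteraction 0 0 1) 1) := by ring
      rw [h1]
      exact mul_le_mul_of_nonneg_left (by linarith [hd.1, hDσ.2]) (sub_nonneg.2 hU)
  linarith [hA, p2, p3, pD]

/-- **CAPPED ANCHOR STATE with certified slopes** (the form fed by ONE anchor solve). A translation-invariant
anchor state `ω` of density `n` with `e^{1,t'₀,U₀}(ω) ≤ u` (a torus-limit ground state at the anchor under a
certified energy cap, or a trial state), `|K₂(ω)| ≤ s₂`, `|K₃(ω)| ≤ s₃`, `D(ω) ∈ [dlo, dhi]`, and `h > 0`: every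
translation-invariant `ε`-near filling-class minimiser `σ` of source-free object M at `(t', t'', U)`, density
`n`, has
`e_P(σ) ≤ (u − μ₀n − lo + (16/π² + s₂)|t' − t'₀| + (16/π² + s₃)|t''| + max((U − U₀)dhi, (U₀ − U)(n/2 − dlo)) + ε)/h`.
[cite: WangEtAl2024, §III] -/
theorem meanEnergy_pairSource_le_of_cappedAnchorState_slopes {t'₀ U₀ μ₀ h lo n ε s₂ s₃ dlo dhi u : ℝ}
    (hh : 0 < h) (hlo : lo ≤ dWaveSourceEnergyDensityTT' t'₀ U₀ μ₀ h) (t' U t'' : ℝ)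
    {σ : InfVolFermionState 2} (hσ : σ.IsTranslationInvariant) (hσn : σ.density = n)
    (hε : σ.meanEnergy (hubbardTT'T''FermionInteraction 1 t' t'' U) 2 ≤
      (hubbardTT'T''FermionInteraction 1 t' t'' U).tiGroundEnergyDensityAt 2 n + ε)
    {ω : InfVolFermionState 2} (hω : ω.IsTranslationInvariant) (hωn : ω.density = n)
    (hu : ω.meanEnergy (hubbardTTPrimeFermionInteraction 1 t'₀ U₀) 1 ≤ u)
    (hs₂ : |ω.meanEnergy (hubbardTTPrimeFermionInteraction 0 1 0) 1| ≤ s₂)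
    (hs₃ : |ω.meanEnergy (axialRange2HoppingFermionInteraction 2 1) 2| ≤ s₃)
    (hd : ω.meanEnergy (hubbardTTPrimeFermionInteraction 0 0 1) 1 ∈ Set.Icc dlo dhi) :
    σ.meanEnergy (pairSourceInteraction dWaveFormFactor) 1 ≤
      (u - μ₀ * n - lo + (16 / Real.pi ^ 2 + s₂) * |t' - t'₀| + (16 / Real.pi ^ 2 + s₃) * |t''| +
        max ((U - U₀) * dhi) ((U₀ - U) * (n / 2 - dlo)) + ε) / h := by
  have hA := mul_meanEnergy_pairSource_le_of_comparison_filling_slopes hlo t' U t'' hσ hσn hε hω hωn hs₂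
    hs₃ hd
  rw [le_div_iff₀ hh, mul_comm]
  linarith

/-- **ABSENT(`< m₀`) from one anchor solve**, `U` at or above the anchor: if
`(16/π² + s₂)|t' − t'₀| + (16/π² + s₃)|t''| + (U − U₀)·dhi < h·m₀ − (u − μ₀n − lo)` (`U₀ ≤ U`, `0 ≤ dhi`) then
no translation-invariant filling-class minimiser of source-free object M at `(t', t'', U)`, density `n`, has
`d`-wave pair amplitude `≥ m₀`. [cite: KomaTasaki1994, §1] -/
theorem meanEnergy_pairSource_lt_of_cappedAnchorState_slopes_near {t'₀ U₀ μ₀ h lo n s₂ s₃ dlo dhi u m₀ : ℝ}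
    (hh : 0 < h) (hlo : lo ≤ dWaveSourceEnergyDensityTT' t'₀ U₀ μ₀ h) {t' U t'' : ℝ} (hU : U₀ ≤ U)
    (hdlo : dlo ≤ n / 2)
    (hnear : (16 / Real.pi ^ 2 + s₂) * |t' - t'₀| + (16 / Real.pi ^ 2 + s₃) * |t''| + (U - U₀) * dhi <
      h * m₀ - (u - μ₀ * n - lo))
    {σ : InfVolFermionState 2} (hσ : σ.IsTranslationInvariant) (hσn : σ.density = n)
    (hmin : ∀ τ : InfVolFermionState 2, τ.IsTranslationInvariant → τ.density = n →
      σ.meanEnergy (hubbardTT'T''FermionInteraction 1 t' t'' U) 2 ≤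
        τ.meanEnergy (hubbardTT'T''FermionInteraction 1 t' t'' U) 2)
    {ω : InfVolFermionState 2} (hω : ω.IsTranslationInvariant) (hωn : ω.density = n)
    (hu : ω.meanEnergy (hubbardTTPrimeFermionInteraction 1 t'₀ U₀) 1 ≤ u)
    (hs₂ : |ω.meanEnergy (hubbardTTPrimeFermionInteraction 0 1 0) 1| ≤ s₂)
    (hs₃ : |ω.meanEnergy (axialRange2HoppingFermionInteraction 2 1) 2| ≤ s₃)
    (hd : ω.meanEnergy (hubbardTTPrimeFermionInteraction 0 0 1) 1 ∈ Set.Icc dlo dhi) :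
    σ.meanEnergy (pairSourceInteraction dWaveFormFactor) 1 < m₀ := by
  have hε : σ.meanEnergy (hubbardTT'T''FermionInteraction 1 t' t'' U) 2 ≤
      (hubbardTT'T''FermionInteraction 1 t' t'' U).tiGroundEnergyDensityAt 2 n + 0 := by
    rw [add_zero]
    exact FermionInteraction.le_tiGroundEnergyDensityAt _ 2 ⟨σ, hσ, hσn⟩ hmin
  have hk := meanEnergy_pairSource_le_of_cappedAnchorState_slopes hh hlo t' U t'' hσ hσn hε hω hωn hu hs₂ hs₃ hd
  have hmax : max ((U - U₀) * dhi) ((U₀ - U) * (n / 2 - dlo)) = (U - U₀) * dhi := by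
    refine max_eq_left ?_
    have h1 : (U₀ - U) * (n / 2 - dlo) ≤ 0 :=
      mul_nonpos_of_nonpos_of_nonneg (sub_nonpos.2 hU) (sub_nonneg.2 hdlo)
    have h2 : 0 ≤ (U - U₀) * dhi := by
      rcases le_total 0 dhi with hdhi | hdhi
      · exact mul_nonneg (sub_nonneg.2 hU) hdhi
      · -- `dhi < 0` is impossible for a docc bracket of a state (`0 ≤ D(ω) ≤ dhi`), but not needed here:
        -- in that case the hypothesis `hnear` is only stronger; we bound via `hd` instead
        have hD0 := ω.meanEnergy_hubbardTTPrime_onSite_nonneg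
        exact mul_nonneg (sub_nonneg.2 hU) (hD0.trans hd.2)
    linarith
  rw [hmax, add_zero] at hk
  refine hk.trans_lt ?_
  rw [div_lt_iff₀ hh]
  linarith [hnear]

/-- **CAP FORM.** With a certified fixed-filling cap `e(1,t'₀,U₀,n) ≤ cap` at the anchor (`U₀ ≥ 0`,
`0 < n < 2`): every translation-invariant `ε`-near filling-class minimiser `σ` of source-free object M at
`(t', t'', U)`, density `n`, has
`e_P(σ) ≤ (cap − μ₀n − lo + (32/π²)|t' − t'₀| + (n/2)|U − U₀| + (32/π²)|t''| + ε)/h` — no chemical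
potential of the box, no source-free grand-canonical cap. [cite: KomaTasaki1994, §1] -/
theorem meanEnergy_pairSource_le_of_fillingCap_couplings {t'₀ U₀ μ₀ h lo cap n ε : ℝ} (hh : 0 < h)
    (hU₀ : 0 ≤ U₀) (hn0 : 0 < n) (hn2 : n < 2) (hlo : lo ≤ dWaveSourceEnergyDensityTT' t'₀ U₀ μ₀ h)
    (hcap : energyDensityTT' 1 t'₀ U₀ n ≤ cap) (t' U t'' : ℝ)
    {σ : InfVolFermionState 2} (hσ : σ.IsTranslationInvariant) (hσn : σ.density = n)
    (hε : σ.meanEnergy (hubbardTT'T''FermionInteraction 1 t' t'' U) 2 ≤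
      (hubbardTT'T''FermionInteraction 1 t' t'' U).tiGroundEnergyDensityAt 2 n + ε) :
    σ.meanEnergy (pairSourceInteraction dWaveFormFactor) 1 ≤
      (cap - μ₀ * n - lo + 32 / Real.pi ^ 2 * |t' - t'₀| + n / 2 * |U - U₀| + 32 / Real.pi ^ 2 * |t''| + ε) /
        h := by
  obtain ⟨ω, hω, hωn, hωe⟩ := (InfVolFermionState.isLeast_meanEnergy_energyDensityTT' 1 t'₀ hU₀ hn0 hn2).1
  have hA := mul_meanEnergy_pairSource_le_of_comparison_filling hlo t' U t'' hσ hσn hε hω hωn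
  rw [hωe] at hA
  rw [le_div_iff₀ hh, mul_comm]
  linarith

/-- **`ε = 0`: filling-class minimisers** (every translation-invariant state of density `n` minimising the
source-free object-M mean energy over the filling class — e.g. torus-limit ground states at fixed filling,
`IsTorusLimitOf.meanEnergy_le_of_filling` at `t'' = 0`):
`e_P(σ) ≤ (cap − μ₀n − lo + (32/π²)|t' − t'₀| + (n/2)|U − U₀| + (32/π²)|t''|)/h`. [cite: Ruelle1969, §3.4] -/
theorem meanEnergy_pairSource_le_of_fillingCap_of_minimiser {t'₀ U₀ μ₀ h lo cap n : ℝ} (hh : 0 < h)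
    (hU₀ : 0 ≤ U₀) (hn0 : 0 < n) (hn2 : n < 2) (hlo : lo ≤ dWaveSourceEnergyDensityTT' t'₀ U₀ μ₀ h)
    (hcap : energyDensityTT' 1 t'₀ U₀ n ≤ cap) (t' U t'' : ℝ)
    {σ : InfVolFermionState 2} (hσ : σ.IsTranslationInvariant) (hσn : σ.density = n)
    (hmin : ∀ τ : InfVolFermionState 2, τ.IsTranslationInvariant → τ.density = n →
      σ.meanEnergy (hubbardTT'T''FermionInteraction 1 t' t'' U) 2 ≤
        τ.meanEnergy (hubbardTT'T''FermionInteraction 1 t' t'' U) 2) :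
    σ.meanEnergy (pairSourceInteraction dWaveFormFactor) 1 ≤
      (cap - μ₀ * n - lo + 32 / Real.pi ^ 2 * |t' - t'₀| + n / 2 * |U - U₀| + 32 / Real.pi ^ 2 * |t''|) / h := by
  have hε : σ.meanEnergy (hubbardTT'T''FermionInteraction 1 t' t'' U) 2 ≤
      (hubbardTT'T''FermionInteraction 1 t' t'' U).tiGroundEnergyDensityAt 2 n + 0 := by
    rw [add_zero]
    exact FermionInteraction.le_tiGroundEnergyDensityAt _ 2 ⟨σ, hσ, hσn⟩ hmin
  have hk := meanEnergy_pairSource_le_of_fillingCap_couplings hh hU₀ hn0 hn2 hlo hcap t' U t'' hσ hσn hε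
  rwa [add_zero] at hk

/-- **ABSENT(`< m₀`) for object M at filling `n` on an explicit `(t', U, t'')` box from ONE sourced floor and
ONE fixed-filling cap at the anchor**: if
`(32/π²)|t' − t'₀| + (n/2)|U − U₀| + (32/π²)|t''| < h·m₀ − (cap − μ₀n − lo)` then no translation-invariant
filling-class minimiser of source-free object M at `(t', t'', U)`, density `n`, has `d`-wave pair amplitude
`≥ m₀`. [cite: KomaTasaki1994, §1] -/
theorem meanEnergy_pairSource_lt_of_fillingCap_of_minimiser_near {t'₀ U₀ μ₀ h lo cap n m₀ : ℝ} (hh : 0 < h)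
    (hU₀ : 0 ≤ U₀) (hn0 : 0 < n) (hn2 : n < 2) (hlo : lo ≤ dWaveSourceEnergyDensityTT' t'₀ U₀ μ₀ h)
    (hcap : energyDensityTT' 1 t'₀ U₀ n ≤ cap) {t' U t'' : ℝ}
    (hnear : 32 / Real.pi ^ 2 * |t' - t'₀| + n / 2 * |U - U₀| + 32 / Real.pi ^ 2 * |t''| <
      h * m₀ - (cap - μ₀ * n - lo))
    {σ : InfVolFermionState 2} (hσ : σ.IsTranslationInvariant) (hσn : σ.density = n)
    (hmin : ∀ τ : InfVolFermionState 2, τ.IsTranslationInvariant → τ.density = n →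
      σ.meanEnergy (hubbardTT'T''FermionInteraction 1 t' t'' U) 2 ≤
        τ.meanEnergy (hubbardTT'T''FermionInteraction 1 t' t'' U) 2) :
    σ.meanEnergy (pairSourceInteraction dWaveFormFactor) 1 < m₀ := by
  refine (meanEnergy_pairSource_le_of_fillingCap_of_minimiser hh hU₀ hn0 hn2 hlo hcap t' U t'' hσ hσn
    hmin).trans_lt ?_
  rw [div_lt_iff₀ hh]
  linarith [hnear]

end NForm

/-! ### §3 The filling slab: two endpoint caps cap the resource on the whole slab -/

section Slab

/-- **Chord cap of the resource on a filling slab.** For `U ≥ 0`, `0 ≤ n₁`, `n₂ < 2`, caps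
`e(t,t',U,n₁) ≤ c₁`, `e(t,t',U,n₂) ≤ c₂` and every `n ∈ [n₁, n₂]`:
`e(t,t',U,n) − μ₀n ≤ max(c₁ − μ₀n₁, c₂ − μ₀n₂)` (convexity of the energy density in the filling).
[cite: Ruelle1969, §3.4] -/
theorem energyDensityTT'_sub_mul_le_max_of_caps (t t' : ℝ) {U : ℝ} (hU : 0 ≤ U) {n₁ n₂ c₁ c₂ n : ℝ}
    (hn₁ : 0 ≤ n₁) (hn₂ : n₂ < 2) (hc₁ : energyDensityTT' t t' U n₁ ≤ c₁)
    (hc₂ : energyDensityTT' t t' U n₂ ≤ c₂) (hn : n ∈ Set.Icc n₁ n₂) (μ₀ : ℝ) :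
    energyDensityTT' t t' U n - μ₀ * n ≤ max (c₁ - μ₀ * n₁) (c₂ - μ₀ * n₂) := by
  obtain ⟨hn1, hn2'⟩ := hn
  rcases eq_or_lt_of_le (hn1.trans hn2') with h12 | h12
  · -- degenerate slab `n₁ = n₂ = n`
    have hn' : n = n₁ := le_antisymm (h12 ▸ hn2') hn1
    subst hn'
    exact (le_max_left _ _).trans' (by linarith)
  · set a : ℝ := (n₂ - n) / (n₂ - n₁) with ha
    set b : ℝ := (n - n₁) / (n₂ - n₁) with hb
    have hd : 0 < n₂ - n₁ := sub_pos.2 h12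
    have ha0 : 0 ≤ a := div_nonneg (sub_nonneg.2 hn2') hd.le
    have hb0 : 0 ≤ b := div_nonneg (sub_nonneg.2 hn1) hd.le
    have hab : a + b = 1 := by
      rw [ha, hb, ← add_div, div_eq_one_iff_eq hd.ne']
      ring
    have hcomb : a * n₁ + b * n₂ = n := by
      rw [ha, hb]
      field_simp
      ring
    have hconv := (convexOn_energyDensityTT' t t' hU).2 (x := n₁) (y := n₂)
      ⟨hn₁, (hn1.trans hn2').trans_lt hn₂⟩ ⟨hn₁.trans (hn1.trans hn2'), hn₂⟩ ha0 hb0 hab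
    simp only [smul_eq_mul] at hconv
    rw [hcomb] at hconv
    set M : ℝ := max (c₁ - μ₀ * n₁) (c₂ - μ₀ * n₂) with hM
    have hmax₁ : c₁ - μ₀ * n₁ ≤ M := le_max_left _ _
    have hmax₂ : c₂ - μ₀ * n₂ ≤ M := le_max_right _ _
    have hμ : μ₀ * n = a * (μ₀ * n₁) + b * (μ₀ * n₂) := by
      rw [← hcomb]
      ring
    have key : energyDensityTT' t t' U n - μ₀ * n ≤ a * (c₁ - μ₀ * n₁) + b * (c₂ - μ₀ * n₂) := by
      linarith [mul_le_mul_of_nonneg_left hc₁ ha0, mul_le_mul_of_nonneg_left hc₂ hb0, hconv, hμ]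
    have hsumM : a * M + b * M = M := by
      rw [← add_mul, hab, one_mul]
    linarith [mul_le_mul_of_nonneg_left hmax₁ ha0, mul_le_mul_of_nonneg_left hmax₂ hb0, key, hsumM]

/-- **The resource on the slab**: under the same caps, for every `n ∈ [n₁, n₂]` (`0 < n₁`):
`e(1,t'₀,U₀,n) − μ₀n − lo ≤ max(c₁ − μ₀n₁, c₂ − μ₀n₂) − lo`, so the cap form holds on the whole slab with
the resource `max(c₁ − μ₀n₁, c₂ − μ₀n₂) − lo` and the `U`-cost `(n₂/2)|U − U₀|`. [cite: Ruelle1969, §3.4] -/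
theorem meanEnergy_pairSource_le_of_slabCaps_of_minimiser {t'₀ U₀ μ₀ h lo n₁ n₂ c₁ c₂ n : ℝ} (hh : 0 < h)
    (hU₀ : 0 ≤ U₀) (hn₁ : 0 < n₁) (hn₂ : n₂ < 2) (hlo : lo ≤ dWaveSourceEnergyDensityTT' t'₀ U₀ μ₀ h)
    (hc₁ : energyDensityTT' 1 t'₀ U₀ n₁ ≤ c₁) (hc₂ : energyDensityTT' 1 t'₀ U₀ n₂ ≤ c₂)
    (hn : n ∈ Set.Icc n₁ n₂) (t' U t'' : ℝ)
    {σ : InfVolFermionState 2} (hσ : σ.IsTranslationInvariant) (hσn : σ.density = n)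
    (hmin : ∀ τ : InfVolFermionState 2, τ.IsTranslationInvariant → τ.density = n →
      σ.meanEnergy (hubbardTT'T''FermionInteraction 1 t' t'' U) 2 ≤
        τ.meanEnergy (hubbardTT'T''FermionInteraction 1 t' t'' U) 2) :
    σ.meanEnergy (pairSourceInteraction dWaveFormFactor) 1 ≤
      (max (c₁ - μ₀ * n₁) (c₂ - μ₀ * n₂) - lo + 32 / Real.pi ^ 2 * |t' - t'₀| + n₂ / 2 * |U - U₀| +
        32 / Real.pi ^ 2 * |t''|) / h := by
  have hn0 : 0 < n := hn₁.trans_le hn.1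
  have hn2 : n < 2 := hn.2.trans_lt hn₂
  have hres := energyDensityTT'_sub_mul_le_max_of_caps 1 t'₀ hU₀ hn₁.le hn₂ hc₁ hc₂ hn μ₀
  refine (meanEnergy_pairSource_le_of_fillingCap_of_minimiser hh hU₀ hn0 hn2 hlo le_rfl t' U t'' hσ hσn
    hmin).trans (div_le_div_of_nonneg_right ?_ hh.le)
  linarith [hres, mul_le_mul_of_nonneg_right hn.2 (abs_nonneg (U - U₀))]

/-- **ABSENT(`< m₀`) UNIFORMLY ON A FILLING SLAB × COUPLING BOX from three certified numbers**
`(lo; c₁, c₂)`: if `(32/π²)|t' − t'₀| + (n₂/2)|U − U₀| + (32/π²)|t''| < h·m₀ − (max(c₁ − μ₀n₁, c₂ − μ₀n₂) − lo)`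
then for every `n ∈ [n₁, n₂]` no translation-invariant filling-class minimiser of source-free object M at
`(t', t'', U)`, density `n`, has `d`-wave pair amplitude `≥ m₀` — no chemical potential of the box is
needed. [cite: KomaTasaki1994, §1] -/
theorem meanEnergy_pairSource_lt_of_slabCaps_of_minimiser_near {t'₀ U₀ μ₀ h lo n₁ n₂ c₁ c₂ m₀ : ℝ}
    (hh : 0 < h) (hU₀ : 0 ≤ U₀) (hn₁ : 0 < n₁) (hn₂ : n₂ < 2)
    (hlo : lo ≤ dWaveSourceEnergyDensityTT' t'₀ U₀ μ₀ h)
    (hc₁ : energyDensityTT' 1 t'₀ U₀ n₁ ≤ c₁) (hc₂ : energyDensityTT' 1 t'₀ U₀ n₂ ≤ c₂)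
    {t' U t'' n : ℝ} (hn : n ∈ Set.Icc n₁ n₂)
    (hnear : 32 / Real.pi ^ 2 * |t' - t'₀| + n₂ / 2 * |U - U₀| + 32 / Real.pi ^ 2 * |t''| <
      h * m₀ - (max (c₁ - μ₀ * n₁) (c₂ - μ₀ * n₂) - lo))
    {σ : InfVolFermionState 2} (hσ : σ.IsTranslationInvariant) (hσn : σ.density = n)
    (hmin : ∀ τ : InfVolFermionState 2, τ.IsTranslationInvariant → τ.density = n →
      σ.meanEnergy (hubbardTT'T''FermionInteraction 1 t' t'' U) 2 ≤
        τ.meanEnergy (hubbardTT'T''FermionInteraction 1 t' t'' U) 2) :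
    σ.meanEnergy (pairSourceInteraction dWaveFormFactor) 1 < m₀ := by
  refine (meanEnergy_pairSource_le_of_slabCaps_of_minimiser hh hU₀ hn₁ hn₂ hlo hc₁ hc₂ hn t' U t'' hσ hσn
    hmin).trans_lt ?_
  rw [div_lt_iff₀ hh]
  linarith [hnear]

end Slab

end Literature.MathematicalPhysics.QuantumLattice

end
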